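import Summits.QuantumFields.BalabanUV.T4Continuum.Support.SubstrateFineFieldChartSU

/-!
# SUBSTRATE — W-24d = LIBRARY L-E18b PART 3, FILE 2∕2: THE DISPLAYED DISC CONDITIONS DISCHARGED AFTER RESCALING THE DIRECTION, THE CANONICAL
# SMALL-FIELD WINDOW IS CLOSED UNDER THE REAL SLICE MOVES, AND W-22′'s `FineFieldChart` INHABITED AT (0.4) WITH NO DISPLAYED HYPOTHESIS
# (`FineFieldChart.canonicalSU` ∕ `FineFieldChart.balabanSU`)

Cell `pub-balaban`, SUBSTRATE cell, seat `b2b-balaban-substrate-p2` (gen 6).  Summits-side under the LEAN PLACEMENT RULE; [folklore] throughout (finite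
products of matrices, `NormedSpace.exp`, continuity of analytic germs, finite intersections of neighbourhoods); FILE 1 `SubstrateFineFieldChartSU`, W-24c-α
`SubstrateComplexAvgTower` (p1 g7), W-24c-β `SubstrateComplexAvgTowerDisc` (p4 g5), W-24b `SubstrateComplexBlockAvg`, W-24a `SubstrateExpChartLog` BY NAME;
nothing printed in [Balaban1985Averaging] ∕ [Balaban1987RG1] is asserted beyond what those modules PROVE; no citation tags.  HONEST FRAMING: rung (B)+1 of
the FINITE-VOLUME T⁴ programme — NOT infinite volume, NOT a mass gap, NOT Clay; spine PROVED 0∕9.  HONEST (typer (π8-2) (ψ4), verbatim): the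
disc depth is EXISTENTIAL by continuity at the real point — NOT the (0.4)–(0.7)-kind quantitative radius; levelwise `Small` DEFINES the window, no
field is claimed small; NO estimate of any NE row.

WHAT IS HERE.
* §1 (any `P`, unitary-valued `ι` with α's `hδ hdist hE`, a field `U` small at every level `< K`) `eventually_loop` — near `z = 0` the iterated loop
  variables of the slice data are `ℰ.δ`-small in both orientations (STRICT at `0` by α `iterRS_hom_eq` + W-24b `loopHolRS_hom_eq` ∕ α `loopHolSR_hom_eq`
  + `Small`; CONTINUOUS by α `analyticAt_iterRS_hom` ∘ W-24b `analyticAt_holRS`; `Filter.eventually_all` over the finite index types); `eventually_prox`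
  — near `0` the slice's `R`-tower is `η`-close to the tower of record (α `analyticAt_towerRS_fst`, `towerSlice_zero_fst`);
  **`exists_rescale_sliceControl`**: for radii bounded below by `ϱ₀ > 0`, SOME rescaled direction `r • H`, `r > 0`, satisfies FILE 1's
  `SliceControl` on the closed unit disc (β `sliceR_smul` ∕ `sliceS_smul` ∕ `towerSlice_smul` move between `r • H` at `z` and `H` at `r z`; FILE 1
  `SliceControl.of_prox`).
* §2 **`small_of_sliceData`**: if the slice data at a parameter ARE `(ι∘U', ι∘U'⁻¹)` of a field `U'` and the `RS`-loop variables there are `ℰ.δ`-small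
  at every level `< K`, then `U'` is small at every level `< K` of its REAL averaging tower (induction on the level with α `iterRS_hom_eq`) — the real
  feet of a controlled slice are window fields.
* §3 (`SU(n)`, `fundamentalRep n`, `expMeanLogSU`; `D` with `admB = univ` and `avB = blockAvg expMeanLogSU`, both `rfl` at `DrivenRuns.balaban`) the
  CANONICAL WINDOW `smallWindow D` (levelwise-small run-B fields) and directions `smallDirs D ϱ U` (`𝔰𝔲(n)`-valued with `SliceControl`);
  `smallWindow_closed` (§2 + FILE 1 `sliceR_moveSU` ∕ `sliceS_moveSU`); **`FineFieldChart.canonicalSU`** — W-22′'s `FineFieldChart` INHABITED with NO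
  displayed hypothesis; `exists_mem_smallDirs` (every `𝔰𝔲(n)`-valued direction at a window field rescales into `smallDirs` when the radii at the
  centre are bounded below — the reading points are as many as the small fields, directions and parameters); **`FineFieldChart.balabanSU`** at
  `DrivenRuns.balaban F K m' expMeanLogSU bgA bgB gA gB` (`rfl`, `rfl`); `hdrv_on_balabanSU` — g38-a's `hdrv` binder ON THE SMALL-FIELD WINDOW, inhabited.

X-READ PLAN. (K) in `exists_rescale_sliceControl` drop `hϱ₀` ⇒ no `η > 0`; in `smallWindow_closed` replace `hH.2.loop` by nothing ⇒ §2 has no input;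
`balabanSU`'s two `rfl` break if `DrivenRuns.balaban` stops averaging by `blockAvg` or restricting nothing.  0 sorry; axioms ⊆ {propext, Classical.choice,
Quot.sound}.
-/

noncomputable section

open scoped Matrix.Norms.L2Operator BigOperators Topology
open Set Metric Filter

namespace Summit.QuantumFields.BalabanUV.T4Continuum.SubstrateFineFieldChartSUWindow

open Literature.MathematicalPhysics.QuantumFieldTheory.Balaban1983to89
open Literature.MathematicalPhysics.QuantumFieldTheory.Balaban1983to89.BlockAveraging (blockAvg Small Idx)
open Literature.MathematicalPhysics.QuantumFieldTheory.Balaban1983to89.ExpMeanLog (eml expMeanLogSU)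
open Literature.MathematicalPhysics.QuantumFieldTheory.Balaban1983to89.T4Continuum (T4Family)
open Literature.MathematicalPhysics.QuantumFieldTheory.Balaban1983to89.T4AdjointCovarianceUnitary (lieSU)
open Literature.MathematicalPhysics.QuantumLattice (fundamentalRep fundamentalRep_mem_unitaryGroup)
open Summit.QuantumFields.BalabanUV.T4Continuum
open Summit.QuantumFields.BalabanUV.T4Continuum.SubstrateTransporterSpecies (towerDataOf)
open Summit.QuantumFields.BalabanUV.T4Continuum.SubstrateChartSection (TwoRunChart sectionOfRecord)
open Summit.QuantumFields.BalabanUV.T4Continuum.SubstrateTwoRunsDriven (DrivenRuns)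
open Summit.QuantumFields.BalabanUV.T4Continuum.SubstrateFineFieldChart (chartAt rho FineFieldChart)
open Summit.QuantumFields.BalabanUV.T4Continuum.SubstrateComplexBlockAvg
open Summit.QuantumFields.BalabanUV.T4Continuum.SubstrateComplexBlockAvgInv
open Summit.QuantumFields.BalabanUV.T4Continuum.SubstrateComplexAvgTower
open Summit.QuantumFields.BalabanUV.T4Continuum.SubstrateComplexAvgTowerDisc (sliceR_smul sliceS_smul towerSlice_smul)
open Summit.QuantumFields.BalabanUV.T4Continuum.SubstrateFineFieldChartSU

/-! ## §1 The displayed disc conditions near the real point, and after rescaling the direction -/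

section Rescale

variable {P : Params} {o : Type*} [Fintype o] [DecidableEq o] {G : Type*} [GaugeGroup G]
  (ℰ : LoopAverage G) (hδ : ℰ.δ ≤ 1 / 3) (ι : G →* Matrix o o ℂ) (hdist : ∀ g : G, ‖ι g - 1‖ = dist1 g)
  (hE : ∀ {m : ℕ} (W : Fin (m + 1) → G), (∀ i, dist1 (W i) < ℰ.δ) → ι (ℰ.E W) = eml fun i => ι (W i))
  (U : GaugeField P 0 G) (H : PBond P 0 → Matrix o o ℂ) (hsmall : ∀ j < P.K, ∀ c, Small ℰ (Averaging.iter (fun _ => blockAvg ℰ) j U) c)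
include hδ hdist hE hsmall

/-- [folklore] **NEAR THE REAL POINT THE ITERATED LOOP VARIABLES OF THE SLICE DATA ARE `ℰ.δ`-SMALL IN BOTH ORIENTATIONS** at every coarse bond of
every level `< K`: strict at `z = 0` (real tie + `Small`), continuous there (α `analyticAt_iterRS_hom` ∘ W-24b `analyticAt_holRS`), finitely many
indices (`Filter.eventually_all`). -/
theorem eventually_loop : ∀ᶠ z in 𝓝 (0 : ℂ), ∀ j < P.K, ∀ c i,
    ‖loopHolRS (iterRS j (sliceR ι U H z, sliceS ι U H z)).1 (iterRS j (sliceR ι U H z, sliceS ι U H z)).2 c i - 1‖ < ℰ.δ ∧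
      ‖loopHolSR (iterRS j (sliceR ι U H z, sliceS ι U H z)).1 (iterRS j (sliceR ι U H z, sliceS ι U H z)).2 c i - 1‖ < ℰ.δ := by
  suffices h : ∀ (j : Fin P.K) (c : PBond P (j + 1)) (i : Idx P), ∀ᶠ z in 𝓝 (0 : ℂ),
      ‖loopHolRS (iterRS j (sliceR ι U H z, sliceS ι U H z)).1 (iterRS j (sliceR ι U H z, sliceS ι U H z)).2 c i - 1‖ < ℰ.δ ∧
        ‖loopHolSR (iterRS j (sliceR ι U H z, sliceS ι U H z)).1 (iterRS j (sliceR ι U H z, sliceS ι U H z)).2 c i - 1‖ < ℰ.δ by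
    exact (eventually_all.2 fun j : Fin P.K => eventually_all.2 fun c => eventually_all.2 fun i => h j c i).mono
      fun z hz j hj c i => hz ⟨j, hj⟩ c i
  intro j c i
  have hs : ∀ j' < (j : ℕ), ∀ c, Small ℰ (Averaging.iter (fun _ => blockAvg ℰ) j' U) c := fun j' hj' => hsmall j' (hj'.trans j.2)
  obtain ⟨h1, h2⟩ := analyticAt_iterRS_hom ℰ hδ ι hdist hE U (R := fun w => sliceR ι U H w) (S := fun w => sliceS ι U H w)
    (fun b => analyticAt_sliceR ι U H 0 b) (fun b => analyticAt_sliceS ι U H 0 b) (sliceR_zero ι U H) (sliceS_zero ι U H) j hs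
  have hRS : AnalyticAt ℂ (fun z => loopHolRS (iterRS j (sliceR ι U H z, sliceS ι U H z)).1 (iterRS j (sliceR ι U H z, sliceS ι U H z)).2 c i) 0 :=
    analyticAt_holRS h1 h2 _
  have hSR : AnalyticAt ℂ (fun z => loopHolSR (iterRS j (sliceR ι U H z, sliceS ι U H z)).1 (iterRS j (sliceR ι U H z, sliceS ι U H z)).2 c i) 0 :=
    analyticAt_holRS h1 h2 _
  have h0 : iterRS (j : ℕ) (sliceR ι U H 0, sliceS ι U H 0) =
      (fun c => ι (Averaging.iter (fun _ => blockAvg ℰ) j U c), fun c => ι (Averaging.iter (fun _ => blockAvg ℰ) j U c)⁻¹) := by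
    rw [sliceR_zero, sliceS_zero]; exact iterRS_hom_eq ℰ hδ ι hdist hE U j hs
  have v1 : ‖loopHolRS (iterRS j (sliceR ι U H 0, sliceS ι U H 0)).1 (iterRS j (sliceR ι U H 0, sliceS ι U H 0)).2 c i - 1‖ < ℰ.δ := by
    rw [h0, loopHolRS_hom_eq, hdist]; exact hsmall j j.2 c i
  have v2 : ‖loopHolSR (iterRS j (sliceR ι U H 0, sliceS ι U H 0)).1 (iterRS j (sliceR ι U H 0, sliceS ι U H 0)).2 c i - 1‖ < ℰ.δ := by
    rw [h0, loopHolSR_hom_eq, hdist, GaugeGroup.dist1_inv]; exact hsmall j j.2 c i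
  exact (((hRS.continuousAt.sub continuousAt_const).norm.tendsto.eventually_lt tendsto_const_nhds v1).and
    ((hSR.continuousAt.sub continuousAt_const).norm.tendsto.eventually_lt tendsto_const_nhds v2))

/-- [folklore] **NEAR THE REAL POINT THE SLICE's `R`-TOWER IS `η`-CLOSE TO THE TOWER OF RECORD** for every `η > 0` (α `analyticAt_towerRS_fst`,
`towerSlice_zero_fst`). -/
theorem eventually_prox {η : ℝ} (hη : 0 < η) :
    ∀ᶠ z in 𝓝 (0 : ℂ), ‖(towerSlice P ι U H z).1 - towerDataOf P ι (fun _ => blockAvg ℰ) U‖ < η := by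
  have hA : AnalyticAt ℂ (fun z => (towerSlice P ι U H z).1) 0 :=
    analyticAt_towerRS_fst ℰ hδ ι hdist hE U (fun b => analyticAt_sliceR ι U H 0 b) (fun b => analyticAt_sliceS ι U H 0 b)
      (sliceR_zero ι U H) (sliceS_zero ι U H) hsmall
  have v : ‖(towerSlice P ι U H 0).1 - towerDataOf P ι (fun _ => blockAvg ℰ) U‖ < η := by
    rw [towerSlice_zero_fst ℰ hδ ι hdist hE U H hsmall, sub_self, norm_zero]; exact hη
  exact (hA.continuousAt.sub continuousAt_const).norm.tendsto.eventually_lt tendsto_const_nhds v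

/-- [folklore] **THE DISPLAYED DISC CONDITIONS HOLD AFTER RESCALING THE DIRECTION**: for radii `ϱ k ≥ ϱ₀ > 0` there is `r > 0` with
`SliceControl ℰ ι U (r • H) ϱ` (a neighbourhood of `0` on which §1's two conditions hold contains the disc of radius `2r`; β's `*_smul` lemmas;
FILE 1 `SliceControl.of_prox` with `η := min (1∕2) (ϱ₀∕4)`). -/
theorem exists_rescale_sliceControl (hι : ∀ g, ι g ∈ Matrix.unitaryGroup o ℂ) {ϱ : ℕ → ℝ} {ϱ₀ : ℝ} (hϱ₀ : 0 < ϱ₀)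
    (hϱ : ∀ k, ϱ₀ ≤ ϱ k) : ∃ r : ℝ, 0 < r ∧ SliceControl ℰ ι U (fun b => (r : ℂ) • H b) ϱ := by
  have hη0 : 0 < min (1 / 2 : ℝ) (ϱ₀ / 4) := lt_min (by norm_num) (by positivity)
  obtain ⟨ε, hε, hball⟩ := Metric.eventually_nhds_iff.1
    ((eventually_loop ℰ hδ ι hdist hE U H hsmall).and (eventually_prox ℰ hδ ι hdist hE U H hsmall hη0))
  have hin : ∀ z ∈ closedBall (0 : ℂ) 1, dist (((ε / 2 : ℝ) : ℂ) * z) 0 < ε := fun z hz => by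
    rw [mem_closedBall_zero_iff] at hz
    rw [dist_zero_right, norm_mul, Complex.norm_real, Real.norm_of_nonneg (by positivity)]
    nlinarith [norm_nonneg z]
  refine ⟨ε / 2, by positivity,
    SliceControl.of_prox (η := min (1 / 2 : ℝ) (ϱ₀ / 4)) hι (min_le_left _ _) (fun k => ?_) (fun z hz => ?_) (fun z hz => ?_)⟩
  · linarith [min_le_right (1 / 2 : ℝ) (ϱ₀ / 4), hϱ k]
  · rw [sliceR_smul, sliceS_smul]; exact (hball (hin z hz)).1
  · rw [towerSlice_smul]; exact (hball (hin z hz)).2.le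

end Rescale

/-! ## §2 The real feet of a controlled slice are small at every level -/

section Feet

variable {P : Params} {𝔸 : Type*} [NormedRing 𝔸] [NormedAlgebra ℂ 𝔸] [CompleteSpace 𝔸] {G : Type*} [GaugeGroup G]

/-- [folklore] **SMALLNESS OF THE REAL FEET**: if the slice data at `z` ARE `(ι∘U', ι∘U'⁻¹)` of a field `U'` and the `RS`-loop variables of their
iterates are `ℰ.δ`-small at every level `< K`, then `U'` is small at every level `< K` of its real averaging tower (induction on the level: α
`iterRS_hom_eq` below the level identifies the iterate with the real average, W-24b `loopHolRS_hom_eq` + `hdist` read the loop variable). -/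
theorem small_of_sliceData (ℰ : LoopAverage G) (hδ : ℰ.δ ≤ 1 / 3) (ι : G →* 𝔸) (hdist : ∀ g : G, ‖ι g - 1‖ = dist1 g)
    (hE : ∀ {m : ℕ} (W : Fin (m + 1) → G), (∀ i, dist1 (W i) < ℰ.δ) → ι (ℰ.E W) = eml fun i => ι (W i))
    {R S : PBond P 0 → 𝔸} {U' : GaugeField P 0 G} (hR : R = fun b => ι (U' b)) (hS : S = fun b => ι (U' b)⁻¹)
    (hloop : ∀ j < P.K, ∀ c i, ‖loopHolRS (iterRS j (R, S)).1 (iterRS j (R, S)).2 c i - 1‖ < ℰ.δ) :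
    ∀ j < P.K, ∀ c, Small ℰ (Averaging.iter (fun _ => blockAvg ℰ) j U') c := by
  subst hR hS
  have key : ∀ j ≤ P.K, ∀ j' < j, ∀ c, Small ℰ (Averaging.iter (fun _ => blockAvg ℰ) j' U') c := by
    intro j
    induction j with
    | zero => exact fun _ j' hj' => absurd hj' (Nat.not_lt_zero _)
    | succ j ih =>
        intro hj j' hj' c
        rcases Nat.lt_succ_iff_lt_or_eq.1 hj' with h | h
        · exact ih (Nat.le_of_succ_le hj) j' h c
        · subst h
          intro i
          have h := hloop j' (by omega) c i
          rw [iterRS_hom_eq ℰ hδ ι hdist hE U' j' (ih (Nat.le_of_succ_le hj)), loopHolRS_hom_eq, hdist] at h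
          exact h
  exact fun j hj c => key P.K le_rfl j hj c

end Feet

/-! ## §3 `SU(n)`: the canonical small-field window, its closure under the real moves, and the chart with no displayed hypothesis -/

section Canonical

variable {n : Type} [Fintype n] [DecidableEq n] [Nonempty n] (D : DrivenRuns (Matrix.specialUnitaryGroup n ℂ))

/-- [folklore] **THE CANONICAL WINDOW**: the admissible run-B fields that are `expMeanLogSU`-small at every level `< K` of their (0.4) averaging tower. -/
def smallWindow : Set D.carriers.BgB :=
  {U | ∀ j < (D.F.P (D.K + 1)).K, ∀ c, Small (expMeanLogSU (n := n)) (Averaging.iter (fun _ => blockAvg (expMeanLogSU (n := n))) j U.1) c}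

/-- [folklore] **THE ADMISSIBLE DIRECTIONS at a centre for radii `ϱ`**: `𝔰𝔲(n)`-valued and satisfying FILE 1's `SliceControl`. -/
def smallDirs (ϱ : ℕ → D.carriers.BgB → ℝ) (U : D.carriers.BgB) : Set (PBond (D.F.P (D.K + 1)) 0 → Matrix n n ℂ) :=
  {H | (∀ b, H b ∈ lieSU n) ∧ SliceControl (expMeanLogSU (n := n)) (fundamentalRep n) U.1 H (fun k => ϱ k U)}

variable {D} {ϱ : ℕ → D.carriers.BgB → ℝ}

/-- [folklore] **THE CANONICAL WINDOW IS CLOSED UNDER THE REAL SLICE MOVES along admissible directions** (unrestricted admissible class): the moved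
field is admissible and, by §2 read through FILE 1 `sliceR_moveSU` ∕ `sliceS_moveSU` at the real parameter `x ∈ closedBall 0 1`, levelwise small. -/
theorem smallWindow_closed (hadm : D.admB = Set.univ) :
    ∀ U ∈ smallWindow D, ∀ H (hH : H ∈ smallDirs D ϱ U), ∀ x : ℝ, |x| < 1 → ∃ U' ∈ smallWindow D, U'.1 = moveSU U.1 H hH.1 x := by
  intro U _ H hH x hx
  refine ⟨⟨moveSU U.1 H hH.1 x, (Set.ext_iff.1 hadm _).2 (Set.mem_univ _)⟩, ?_, rfl⟩
  exact small_of_sliceData (expMeanLogSU (n := n)) expMeanLogSU_δ_le_third (fundamentalRep n) (fun _ => rfl)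
    (fun W hW => fundamentalRep_expMeanLogSU_E W hW) (sliceR_moveSU U.1 H hH.1 x) (sliceS_moveSU U.1 H hH.1 x)
    fun j hj c i => (hH.2.loop x (ofReal_mem_closedBall hx) j hj c i).1

/-- [folklore] **W-22′'s `FineFieldChart` INHABITED AT (0.4) WITH NO DISPLAYED HYPOTHESIS** (`admB = univ`, `avB = blockAvg expMeanLogSU`): window :=
the canonical small-field window, reading points := (small centre, admissible direction, parameter of modulus `≤ r`), slices := α's tower chart
coordinates — FILE 1 `FineFieldChart.ofSlicesSU` with `smallWindow_closed`. -/
def FineFieldChart.canonicalSU (hadm : D.admB = Set.univ) (havB : D.avB = fun _ => blockAvg (expMeanLogSU (n := n)))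
    (ϱ : ℕ → D.carriers.BgB → ℝ) (r : ℝ) :
    FineFieldChart D (fundamentalRep n) (smallWindow D) (SlicePoint D (smallWindow D) (smallDirs D ϱ) r)
      (SlicePoint.emb D (fundamentalRep n) (expMeanLogSU (n := n))) ϱ r :=
  FineFieldChart.ofSlicesSU havB (fun _ hU => hU) (fun _ _ _ hH => hH.2) (fun _ _ hH => hH.1) (smallWindow_closed hadm)

/-- [folklore] **THE READING POINTS ARE PLENTIFUL**: at a window field whose radii are bounded below by `ϱ₀ > 0`, every `𝔰𝔲(n)`-valued direction
rescales into `smallDirs` (§1 `exists_rescale_sliceControl`, FILE 1 `smul_mem_lieSU`). -/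
theorem exists_mem_smallDirs {U : D.carriers.BgB} (hU : U ∈ smallWindow D) {H : PBond (D.F.P (D.K + 1)) 0 → Matrix n n ℂ}
    (hH : ∀ b, H b ∈ lieSU n) {ϱ₀ : ℝ} (hϱ₀ : 0 < ϱ₀) (hϱ : ∀ k, ϱ₀ ≤ ϱ k U) :
    ∃ r : ℝ, 0 < r ∧ (fun b => (r : ℂ) • H b) ∈ smallDirs D ϱ U := by
  obtain ⟨r, hr, hc⟩ := exists_rescale_sliceControl (expMeanLogSU (n := n)) expMeanLogSU_δ_le_third (fundamentalRep n) (fun _ => rfl)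
    (fun W hW => fundamentalRep_expMeanLogSU_E W hW) U.1 H hU (fun g => fundamentalRep_mem_unitaryGroup g) hϱ₀ hϱ
  exact ⟨r, hr, fun b => smul_mem_lieSU (hH b) r, hc⟩

/-- [folklore] **AT BAŁABAN's DRIVEN RUNS** `DrivenRuns.balaban F K m' expMeanLogSU bgA bgB gA gB` (unrestricted classes, `blockAvg expMeanLogSU` at every
level of run B — both `rfl`): the fine-field chart of road D on the canonical small-field window, NO displayed hypothesis. -/
def FineFieldChart.balabanSU (F : T4Family) (K m' : ℕ)
    (bgA : Background (F.P K) (Matrix.specialUnitaryGroup n ℂ) (fun j => blockAvg (j := j) (expMeanLogSU (n := n))))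
    (bgB : Background (F.P (K + 1)) (Matrix.specialUnitaryGroup n ℂ) (fun j => blockAvg (j := j) (expMeanLogSU (n := n)))) (gA gB : ℕ → ℝ)
    (ϱ : ℕ → (DrivenRuns.balaban F K m' (expMeanLogSU (n := n)) bgA bgB gA gB).carriers.BgB → ℝ) (r : ℝ) :
    FineFieldChart (DrivenRuns.balaban F K m' (expMeanLogSU (n := n)) bgA bgB gA gB) (fundamentalRep n) (smallWindow _)
      (SlicePoint _ (smallWindow _) (smallDirs _ ϱ) r) (SlicePoint.emb _ (fundamentalRep n) (expMeanLogSU (n := n))) ϱ r :=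
  FineFieldChart.canonicalSU rfl rfl ϱ r

/-- [folklore] **THE END — g38-a's `hdrv` binder ON THE SMALL-FIELD WINDOW of Bałaban's driven runs, INHABITED** (W-22′ `FineFieldChart.hdrv_on` at the
chart of `balabanSU`: `Ctr := ↥smallWindow`, `χ b := chartAt _ (fundamentalRep n) b.1`, `ρ := rho _ (fundamentalRep n) smallWindow`). -/
theorem hdrv_on_balabanSU (F : T4Family) (K m' : ℕ)
    (bgA : Background (F.P K) (Matrix.specialUnitaryGroup n ℂ) (fun j => blockAvg (j := j) (expMeanLogSU (n := n))))
    (bgB : Background (F.P (K + 1)) (Matrix.specialUnitaryGroup n ℂ) (fun j => blockAvg (j := j) (expMeanLogSU (n := n)))) (gA gB : ℕ → ℝ)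
    (ϱ : ℕ → (DrivenRuns.balaban F K m' (expMeanLogSU (n := n)) bgA bgB gA gB).carriers.BgB → ℝ) (r : ℝ) {W : Set (ℕ → ℝ)} {E : Type*} :
    ∀ k, ∀ g ∈ W, ∀ (u : SlicePoint _ (smallWindow (DrivenRuns.balaban F K m' (expMeanLogSU (n := n)) bgA bgB gA gB)) (smallDirs _ ϱ) r) (e : E),
      ∃ (b : smallWindow _) (a : ℂ → _) (z₀ : ℂ), ‖z₀‖ ≤ r ∧
        chartAt _ (fundamentalRep n) b.1 (a z₀) = SlicePoint.emb _ (fundamentalRep n) (expMeanLogSU (n := n)) u ∧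
        (∀ x : ℝ, |x| < 1 → chartAt _ (fundamentalRep n) b.1 (a x) ∈ Set.range (rho _ (fundamentalRep n) (smallWindow _))) ∧
        DiffContOnCl ℂ a (ball 0 1) ∧ MapsTo a (closedBall 0 1) (ball 0 (ϱ k b.1)) :=
  (FineFieldChart.balabanSU F K m' bgA bgB gA gB ϱ r).hdrv_on

end Canonical

end Summit.QuantumFields.BalabanUV.T4Continuum.SubstrateFineFieldChartSUWindow

end
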